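import Literature.NumberTheory.GelbartRogawski1991.WeilLiftNonsplitPrincipalSeriesConstituent
import Literature.NumberTheory.Rogawski1990.XiLocalCharacter
import Summits.HodgeConjecture.HodgeConjecture.Theorems.F0P2oStubDictTorusChar   -- ★ p826011 F0P2-p02 (g5): K2 closer `stubDictTorusChar_holds` (edition v1.1)
import Summits.HodgeConjecture.HodgeConjecture.Theorems.F0P2oThetaInPSOfLetters  -- ★ p828142 B-p18 (g28): K1 composition `stubThetaInPS_of_letters (hN3) (hW) (hU1)` (edition v1.2)
import Literature.NumberTheory.GelbartRogawski1991.ThetaTypeNonsplitJacquetModule   -- ★ p826177 typ-T7a (g0): THE N3 LETTER `thetaType_nonsplit_jacquetModule`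
import Literature.NumberTheory.Rogawski1990.U3PrincipalSeriesWeylConjugate         -- ★ p826332 typ-T7a (g0): THE K1w LETTER `cmPrincipalSeries_isConstituentOf_weylConj`
import Literature.NumberTheory.GelbartRogawski1991.U1ThetaDichotomy                 -- ★ p826953∕p827180 typ-T7b (g0): THE U1 LETTER `u1ThetaDichotomy_nonsplit`
import HarnessLib

/-!
# Crux `H413`, programme P2 — THE LETTERS-ONLY CLOSER OF PRINT LETTER #76 `GR91Lemma512NonsplitAsPrinted` (U′-N):
# `GR91N_of_letters (hN3) (hW) (hU1)`

Cell hodgecm-mathlib (D-0151), FLOOR 0, crux item H413 = stmt-HodgeConjecture-24833, route of record `HCCMUnconditional`; programme P2, socket 27455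
`F0HdictE`, PKΠ line `Cruxes/H413/Lines/F0_P2PKPiRung4.lean` (:538 `stub_GR91N : GR91Lemma512NonsplitAsPrinted`, letter #76 BY NAME).  Row «GR91N-TWIN»
(desk F0P2-plan (g8), 2026-08-31): the parent pay-down line `Cruxes/H413/Lines/F0_P2GR91NJacquet.lean` (edition v1.2) proves `GR91N_of_stubs : StubThetaInPS →
StubDictTorusChar → GR91Lemma512NonsplitAsPrinted` and closes both stubs BY NAME over `Theorems/` files — K1 by ★ `F0P2oThetaInPSOfLetters.stubThetaInPS_of_letters
(hN3) (hW) (hU1)` (B-p18 (g28), p828142) and K2 by ★ `F0P2oStubDictTorusChar.stubDictTorusChar_holds` (F0P2-p02 (g5), p826011).  THIS file is the same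
composition WITHOUT any `Cruxes.H413.Lines.*` import (O50-1): one theorem

  `GR91N_of_letters (hN3) (hW) (hU1) : GelbartRogawski1991.GR91Lemma512NonsplitAsPrinted`,

CONDITIONAL on exactly the three print letters, taken BY NAME as hypotheses: `hN3 : thetaType_nonsplit_jacquetModule` [GelbartRogawski1991 §3.2 (3.2.1)–(3.2.2)
p. 457; Kudla1986 Thm. 2.8] (★ p826177), `hW : cmPrincipalSeries_isConstituentOf_weylConj` [Rogawski1990 §12.2 p. 174 L3–5; BernsteinZelevinsky1977 Thm. 2.9]
(★ p826332), `hU1 : u1ThetaDichotomy_nonsplit` [HarrisKudlaSweet1996 Cor. 4.4; Rogawski1992 Prop. 3.4] (★ p826953 ∕ p827180).  The consumer is the desk's PKΠ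
EDITION v1.5 «GR91N FOLD»: `stub_GR91N := F0P2oGR91NOfLetters.GR91N_of_letters stub_N3_letter stub_K1w_letter stub_U1_letter`.  So print letter #76 ⟸ {N3, K1w, U1}:
three smaller standard local statements replace one paper-specific one.  HC_CM is proved only modulo the printed citations until rung 0 closes; this file
proves no letter — it composes (no definition, no named fact, no instance, no notation, no `sorry`).

## Proof (= the parent's `GR91N_of_stubs` :198–204, pasted)
Given the letter's data `(L, H, e₁, dV, g, ξ, μω, μ, χ_f, v, T, a)` with the two DICTIONARY hypotheses: K1 (★ `stubThetaInPS_of_letters hN3 hW hU1`) yields a line class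
`ε`, a class `x₀` and a character `ψθ` of `E¹_v` with ★ `IsThetaCenterChar L μ χf ε v ψθ`, `x₀` a constituent of `i_G(cmXiTorusChar L v μ_v ψθ⁻¹ ψθ)` and the
theta-type clause; K2 (★ `stubDictTorusChar_holds`, whose centre-character binder is the δ-unfolded body of `IsThetaCenterChar`) rewrites Rogawski's
`cmXiTorusChar L v μω_v η_v ψ_v` into `cmXiTorusChar L v μ_v ψθ⁻¹ ψθ` — `ξ` eliminates.

## References
- [GelbartRogawski1991] S. Gelbart, J. Rogawski, *L-functions and Fourier–Jacobi coefficients for the unitary group U(3)*, Invent. Math. 105 (1991) — §5.1 (5.1.1), Lem. 5.1.2.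
- [Rogawski1990] J. Rogawski, *Automorphic Representations of Unitary Groups in Three Variables*, Ann. of Math. Stud. 123 — §12.1 p. 172, §12.2 (2) p. 174.
- [Kudla1986] S. Kudla, *On the local theta-correspondence*, Invent. Math. 83 (1986) — Thm. 2.8.
- [HarrisKudlaSweet1996] M. Harris, S. Kudla, W. J. Sweet, *Theta dichotomy for unitary groups*, JAMS 9 (1996) — Cor. 4.4.
-/

set_option autoImplicit false
-- the mandated namespace has the single-problem summit's repeated segment (`HodgeConjecture.HodgeConjecture`)
set_option linter.dupNamespace false

noncomputable section

open NumberField IsDedekindDomain MeasureTheory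
open scoped Matrix

open Literature.NumberTheory Literature.NumberTheory.Automorphic Literature.NumberTheory.Automorphic.UnitaryGroup
open Literature.NumberTheory.Automorphic.IdeleClassGroup
open Literature.NumberTheory.Automorphic.Liu2021 Literature.NumberTheory.Automorphic.Liu2021.Def411WeilCarriers
open Literature.NumberTheory.GaloisRepresentations
open Literature.NumberTheory.Rogawski1990
open Literature.NumberTheory.GelbartRogawski1991

namespace Summit.HodgeConjecture.HodgeConjecture.Cruxes.H413.F0P2oGR91NOfLetters

set_option synthInstance.maxHeartbeats 400000 in
set_option maxHeartbeats 8000000 in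
/-- **PRINT LETTER #76 `GR91Lemma512NonsplitAsPrinted` FROM THE THREE PRINT LETTERS N3, K1w, U1** (the parent line's `GR91N_of_stubs` with K1 := ★
`F0P2oThetaInPSOfLetters.stubThetaInPS_of_letters hN3 hW hU1` and K2 := ★ `F0P2oStubDictTorusChar.stubDictTorusChar_holds`, composed without a `Lines` import):
at a non-split `v`, under the dictionary hypotheses for `(ξ, μω)` and `(μ, χ_f)` and a form congruence `ᵗT̄ H_v T = a·Φ₃`, some constituent `x₀` of
`i_G(χ_ξ)`, `χ_ξ = cmXiTorusChar L v μω_v η_v ψ_v`, transports to the local theta type `X_v(μ, ε, χ_f) ∘ κ_v⁻¹` for some line class `ε`.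
[cite: GelbartRogawski1991, §5.1 (5.1.1) p. 465, Lem. 5.1.2 pp. 465–466] [cite: Rogawski1990, §12.2 (2) p. 174] [cite: Kudla1986, Thm. 2.8] [cite: HarrisKudlaSweet1996, Cor. 4.4] -/
theorem GR91N_of_letters
    (hN3 : Literature.NumberTheory.GelbartRogawski1991.thetaType_nonsplit_jacquetModule)
    (hW : Literature.NumberTheory.Rogawski1990.cmPrincipalSeries_isConstituentOf_weylConj)
    (hU1 : Literature.NumberTheory.GelbartRogawski1991.u1ThetaDichotomy_nonsplit) :
    Literature.NumberTheory.GelbartRogawski1991.GR91Lemma512NonsplitAsPrinted := by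
  intro L _ _ _ H hH hHd n' e₁ dV hdV hdV0 g hg ξ μω hμu hquad μ hμ χf hcont hunit hdμ hdχ v hv T a ha h
  obtain ⟨ε, x₀, ψθ, hspec, hconst, hθ⟩ :=
    F0P2oThetaInPSOfLetters.stubThetaInPS_of_letters hN3 hW hU1 L H hH hHd e₁ dV hdV hdV0 g hg μ hμ χf hcont hunit v hv T a ha h
  refine ⟨x₀, ?_, ε, hθ⟩
  rw [F0P2oStubDictTorusChar.stubDictTorusChar_holds L ξ μω hμu hquad μ hμ χf hcont hunit hdμ hdχ v hv ε ψθ hspec]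
  exact hconst

end Summit.HodgeConjecture.HodgeConjecture.Cruxes.H413.F0P2oGR91NOfLetters

end
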